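import Mathlib
import Literature.Barriers.ValiantsHypothesis.AlgebraicNaturalProofs
import Literature.Computability.AlgebraicComplexity.ArithCircuitProofs
import Summits.ValiantsHypothesis.ValiantsHypothesis.Theorems.BarrierLeverSuccinctHittingSetsForVPStubSeparableCoeff
import Summits.ValiantsHypothesis.ValiantsHypothesis.Theorems.BarrierLeverSuccinctHittingSetsForVPGenerator
import Summits.ValiantsHypothesis.ValiantsHypothesis.Theorems.BarrierLeverSuccinctHittingSetsForVPStubSps2Hit
import HarnessLib
import Literature.Computability.AlgebraicComplexity.DepthThreeVariableReduction

/-!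
# Crux `BarrierLever.SuccinctHittingSetsForVP` (stmt-ValiantsHypothesis-14610), line `registered` —
`ΣΠΣ(k)` DISTINGUISHERS (BOUNDED TOP FAN-IN `k ≤ n`) ARE HIT, CONDITIONALLY on Saxena–Seshadhri's
variable reduction (lead c4; FSV18 §4.1 / Cor. 22 transported to regime `d = n`)

**What is proved (CONDITIONAL on the named fact `SaxenaSeshadhri2012_lemma11`, a published theorem
stated below and not proved here; it does NOT close the item).**

* `stub_spskHit` / `isSuccinctHittingSet_spsk` : for `n ≥ 8` and `k ≤ n`, the coefficient vectors of
  `SmallCircuits ℂ n 10` hit every nonzero distinguisher `D = Σ_{i<k} ∏_{j<d_i} ℓ_{ij}` with affine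
  forms `ℓ_{ij}` (total degree `≤ 1`, constants allowed) of the `N = C(2n,n)` coefficient variables —
  depth-3 of top fan-in `k`, any degree, any size. The case `k = 2` is UNCONDITIONAL (`Sps2`, p164336).

**Proof.** Rename the coefficient variables injectively into `Fin M`, `M = (n+1)^n`, along the
Kronecker index `κ(μ) = Σ_l μ_l (n+1)^l` (`D ↦ rename κ D ≠ 0`, again a `ΣΠΣ(k)` circuit with affine
forms). Saxena–Seshadhri's variable reduction (Lemma 11: some Vandermonde homomorphism
`Ψ_β : x_i ↦ Σ_{j≤k} β^{ij} y_j`, `β` from any set of `d M k² + 1` scalars, keeps it nonzero) leaves a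
nonzero polynomial in `y_1, …, y_k`, hence a non-root `y*` (`ℂ` infinite). At `y*` the point
`c*_i = Σ_j β^{ij} y*_j` pulled back along `κ` is GEOMETRIC in `μ`:
`c*_{κ μ} = Σ_j (β^{j} y*_j) ∏_l (β^{j (n+1)^l})^{μ_l}` (with the `1`-based shifts of the source), i.e.
the value of the `k`-seed separable generator, which is the coefficient vector of
`Σ_j (β^j y*_j) Λ_{s_j} ∈ SmallCircuits ℂ n 10` (`Λ_s` from `stub_separableCoeff`, p153631; `k ≤ n`).
This is exactly FSV18's route (§4.1: the succinct rank condenser specialises to the Gabizon–Raz /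
Karnin–Shpilka Vandermonde map, Prop. 17, and Fact 19 / Lemma 21 give the generator property), with
Saxena–Seshadhri's field-independent Lemma 11 in place of the rank-bound Fact 19.
Axioms: `propext`, `Classical.choice`, `Quot.sound` (+ the named hypothesis).

References: [SaxenaSeshadhri2012] N. Saxena, C. Seshadhri, SIAM J. Comput. 41 (2012) 1285–1298
(arXiv:1011.3234), §3.2 eq. (2), Lemma 7, Lemma 11, Theorems 2–3; [ForbesShpilkaVolk2018] §4.1,
Construction 16, Prop. 17, Fact 19, Lemmas 20–21, Cor. 22.
-/

-- layout Summits/ValiantsHypothesis/ValiantsHypothesis forces the duplicated namespace component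
set_option linter.dupNamespace false

namespace Summit.ValiantsHypothesis.ValiantsHypothesis.Theorems.BarrierLever.SuccinctHittingSetsForVP

open Literature.Barriers.ValiantsHypothesis Literature.Computability.AlgebraicComplexity MvPolynomial

namespace Spsk

variable {n : ℕ}

/-- The Kronecker index `κ(μ) = Σ_l μ_l (n+1)^l` of an exponent vector with entries `≤ n` is
`< (n+1)^n`. [folklore] -/
theorem kronecker_lt (μ : Fin n →₀ ℕ) (hμ : ∀ l, μ l ≤ n) :
    ∑ l : Fin n, μ l * (n + 1) ^ (l : ℕ) < (n + 1) ^ n := by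
  -- digits in base `n+1`
  have key : ∀ m : ℕ, ∀ (ν : Fin m → ℕ), (∀ l, ν l ≤ n) →
      ∑ l : Fin m, ν l * (n + 1) ^ (l : ℕ) < (n + 1) ^ m := by
    intro m
    induction m with
    | zero => intro ν _; simp
    | succ m ih =>
      intro ν hν
      rw [Fin.sum_univ_castSucc]
      have h1 := ih (fun l => ν (Fin.castSucc l)) fun l => hν _
      have h2 : ν (Fin.last m) ≤ n := hν _
      simp only [Fin.val_castSucc, Fin.val_last] at h1 ⊢
      calc ∑ l : Fin m, ν (Fin.castSucc l) * (n + 1) ^ (l : ℕ) + ν (Fin.last m) * (n + 1) ^ m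
          < (n + 1) ^ m + n * (n + 1) ^ m :=
            add_lt_add_of_lt_of_le h1 (Nat.mul_le_mul_right _ h2)
        _ = (n + 1) ^ (m + 1) := by ring
  exact key n (fun l => μ l) hμ

/-- The Kronecker index is injective on exponent vectors with entries `≤ n` (uniqueness of base-`(n+1)`
digits). [folklore] -/
theorem kronecker_injective :
    Function.Injective (fun μ : degLEMonomials n =>
      (⟨∑ l : Fin n, (μ : Fin n →₀ ℕ) l * (n + 1) ^ (l : ℕ),
        kronecker_lt _ fun l => (Finsupp.le_degree l _).trans μ.2⟩ : Fin ((n + 1) ^ n))) := by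
  intro μ ν h
  rcases Nat.eq_zero_or_pos n with hn0 | hnpos
  · subst hn0
    exact Subtype.ext (Subsingleton.elim _ _)
  have h' : ∑ l : Fin n, (μ : Fin n →₀ ℕ) l * (n + 1) ^ (l : ℕ) =
      ∑ l : Fin n, (ν : Fin n →₀ ℕ) l * (n + 1) ^ (l : ℕ) := by
    simpa using congrArg Fin.val h
  have hμ : ∀ l, (μ : Fin n →₀ ℕ) l < n + 1 := fun l =>
    Nat.lt_succ_of_le ((Finsupp.le_degree l _).trans μ.2)
  have hν : ∀ l, (ν : Fin n →₀ ℕ) l < n + 1 := fun l =>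
    Nat.lt_succ_of_le ((Finsupp.le_degree l _).trans ν.2)
  -- compare base-(n+1) digit expansions via `Nat.ofDigits`
  have hdig : ∀ (ρ : Fin n →₀ ℕ), (∀ l, ρ l < n + 1) →
      ∑ l : Fin n, ρ l * (n + 1) ^ (l : ℕ) = Nat.ofDigits (n + 1) (List.ofFn fun l : Fin n => ρ l) := by
    intro ρ _
    rw [Nat.ofDigits_eq_sum_mapIdx, List.mapIdx_eq_ofFn]
    simp [List.sum_ofFn]
  rw [hdig _ hμ, hdig _ hν] at h'
  have hlen : (List.ofFn fun l : Fin n => (μ : Fin n →₀ ℕ) l).length =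
      (List.ofFn fun l : Fin n => (ν : Fin n →₀ ℕ) l).length := by simp
  have hinj := Nat.ofDigits_inj_of_len_eq (b := n + 1) (by omega) hlen
    (fun x hx => by
      obtain ⟨l, rfl⟩ := (List.mem_ofFn' _ _).mp hx
      exact hμ l)
    (fun x hx => by
      obtain ⟨l, rfl⟩ := (List.mem_ofFn' _ _).mp hx
      exact hν l) h'
  apply Subtype.ext
  ext l
  have := congrArg (fun L => L.getD l 0) hinj
  simpa [List.getD_eq_getElem?_getD] using this

/-- Realisability of the `k`-seed separable generator (size and degree): if `Λ_j ∈ SmallCircuits ℂ n 8`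
(`j < k ≤ n`) and `n ≥ 8`, then `Σ_j c_j Λ_j ∈ SmallCircuits ℂ n 10`. [cite: ForbesShpilkaVolk2018, Construction 25] -/
theorem sum_mem_smallCircuits {k : ℕ} (hn : 8 ≤ n) (hk : k ≤ n)
    {Λ : Fin k → MvPolynomial (Fin n) ℂ} (hΛ : ∀ j, Λ j ∈ SmallCircuits ℂ n 8) (c : Fin k → ℂ) :
    ∑ j : Fin k, C (c j) * Λ j ∈ SmallCircuits ℂ n 10 := by
  refine ⟨totalDegree_finsetSum_le fun j _ => ?_, ?_⟩
  · calc (C (c j) * Λ j).totalDegree ≤ (C (c j) : MvPolynomial (Fin n) ℂ).totalDegree +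
          (Λ j).totalDegree := totalDegree_mul _ _
      _ ≤ n := by rw [totalDegree_C, zero_add]; exact (hΛ j).1
  · calc complexity (∑ j : Fin k, C (c j) * Λ j)
        ≤ ∑ j : Fin k, complexity (C (c j) * Λ j) + (Finset.univ : Finset (Fin k)).card :=
          complexity_finset_sum_le _ _
      _ ≤ (∑ _j : Fin k, (n ^ 8 + 1)) + k := by
          gcongr with j _
          · calc complexity (C (c j) * Λ j)
                ≤ complexity (C (c j) : MvPolynomial (Fin n) ℂ) + complexity (Λ j) + 1 :=
                  complexity_mul_le_holds _ _
              _ ≤ 0 + n ^ 8 + 1 := by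
                  rw [complexity_C_holds]
                  gcongr
                  exact (hΛ j).2
              _ = n ^ 8 + 1 := by ring
          · rw [Finset.card_univ, Fintype.card_fin]
      _ ≤ n ^ 10 := by
          rw [Finset.sum_const, Finset.card_univ, Fintype.card_fin, smul_eq_mul]
          have h8 : 1 ≤ n ^ 8 := Nat.one_le_pow _ _ (by omega)
          calc k * (n ^ 8 + 1) + k ≤ n * (n ^ 8 + 1) + n := by gcongr
            _ ≤ 3 * n ^ 9 := by nlinarith [h8]
            _ ≤ n * n ^ 9 := Nat.mul_le_mul_right _ (by omega)
            _ = n ^ 10 := by ring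

/-- **Realisability of the `k`-seed separable generator in `SmallCircuits ℂ n 10`** (`n ≥ 8`, `k ≤ n`):
for any weights `y` and seeds `s`, some `f ∈ SmallCircuits ℂ n 10` has
`coeff_μ f = Σ_j y_j ∏_l s_{j,l}^{μ_l}`. [cite: ForbesShpilkaVolk2018, Construction 25 and §3] -/
theorem realisable {k : ℕ} (hn : 8 ≤ n) (hk : k ≤ n) (y : Fin k → ℂ) (s : Fin k → Fin n → ℂ) :
    ∃ f ∈ SmallCircuits ℂ n 10, ∀ μ : degLEMonomials n,
      coeff (μ : Fin n →₀ ℕ) f = ∑ j : Fin k, y j * ∏ l : Fin n, s j l ^ (μ : Fin n →₀ ℕ) l := by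
  choose Λ hΛmem hΛcoeff using fun j : Fin k => stub_separableCoeff n hn (fun l e => s j l ^ e)
  refine ⟨∑ j : Fin k, C (y j) * Λ j, sum_mem_smallCircuits hn hk hΛmem _, fun μ => ?_⟩
  rw [coeff_sum]
  simp only [coeff_C_mul, hΛcoeff]

/-- The Vandermonde point pulled back along the Kronecker index is geometric:
`β^{(κ μ + 1)(j+1)} = β^{j+1} ∏_l (β^{(j+1)(n+1)^l})^{μ_l}`. [folklore] -/
theorem pow_kronecker (β : ℂ) (j : ℕ) (μ : Fin n →₀ ℕ) :
    β ^ ((∑ l : Fin n, μ l * (n + 1) ^ (l : ℕ) + 1) * (j + 1)) =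
      β ^ (j + 1) * ∏ l : Fin n, (β ^ ((j + 1) * (n + 1) ^ (l : ℕ))) ^ μ l := by
  rw [add_mul, one_mul, pow_add, mul_comm (β ^ (j + 1)), Finset.sum_mul,
    ← Finset.prod_pow_eq_pow_sum]
  congr 1
  refine Finset.prod_congr rfl fun l _ => ?_
  rw [← pow_mul]
  congr 1
  ring

end Spsk

open Spsk

/-- **Registered stub `stub_spskHit`** (crux stmt-ValiantsHypothesis-14610, line `registered`; lead
c4): CONDITIONAL on Saxena–Seshadhri's Lemma 11 (stated verbatim as the hypothesis), for `n ≥ 8`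
and `k ≤ n` the coefficient vectors of `SmallCircuits ℂ n 10` hit every nonzero `ΣΠΣ(k)` polynomial
`Σ_{i<k} ∏_{j<d_i} ℓ_{ij}` in the coefficient variables with affine `ℓ_{ij}` (FSV18 Cor. 22 in regime
`d = n`). [cite: ForbesShpilkaVolk2018, §4.1 and Cor. 22] [cite: SaxenaSeshadhri2012, Lemma 11] -/
theorem stub_spskHit :
    (∀ (F : Type) [Field F] (k d n : ℕ) (dd : Fin k → ℕ), (∀ i, dd i ≤ d) →
      ∀ (ℓ : (i : Fin k) → Fin (dd i) → MvPolynomial (Fin n) F),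
        (∀ i j, (ℓ i j).totalDegree ≤ 1) →
        (∑ i, ∏ j, ℓ i j) ≠ 0 →
        ∀ U : Finset F, d * n * k ^ 2 + 1 ≤ U.card →
          ∃ β ∈ U, MvPolynomial.aeval
            (fun i : Fin n => ∑ j : Fin k,
              MvPolynomial.C (β ^ ((i.1 + 1) * (j.1 + 1))) * (MvPolynomial.X j : MvPolynomial (Fin k) F))
            (∑ i, ∏ j, ℓ i j) ≠ 0) →
    ∀ n k : ℕ, 8 ≤ n → k ≤ n →
      IsSuccinctHittingSet (degLEMonomials n) (SmallCircuits ℂ n 10)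
        {D | ∃ (dd : Fin k → ℕ) (ℓ : (i : Fin k) → Fin (dd i) → MvPolynomial (degLEMonomials n) ℂ),
          (∀ i j, (ℓ i j).totalDegree ≤ 1) ∧ D = ∑ i, ∏ j, ℓ i j} := by
  intro hSS n k hn hk
  classical
  rintro D ⟨dd, ℓ, hℓ, rfl⟩ hD0
  -- Kronecker renaming into `Fin M`
  set M := (n + 1) ^ n with hM
  let κ : degLEMonomials n → Fin M := fun μ =>
    ⟨∑ l : Fin n, (μ : Fin n →₀ ℕ) l * (n + 1) ^ (l : ℕ),
      kronecker_lt _ fun l => (Finsupp.le_degree l _).trans μ.2⟩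
  have hκ : Function.Injective κ := kronecker_injective
  have hD' : (∑ i, ∏ j, rename κ (ℓ i j)) ≠ 0 := by
    have : rename κ (∑ i, ∏ j, ℓ i j) ≠ 0 := fun h0 =>
      hD0 (rename_injective κ hκ (by rw [h0, map_zero]))
    simpa only [map_sum, map_prod] using this
  have hℓ' : ∀ i j, (rename κ (ℓ i j)).totalDegree ≤ 1 := fun i j =>
    (totalDegree_rename_le _ _).trans (hℓ i j)
  -- the finite set of scalars `U = {2, 3, …}` of size `d M k² + 1`
  set d := Finset.univ.sup dd with hd
  have hdd : ∀ i, dd i ≤ d := fun i => Finset.le_sup (Finset.mem_univ i)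
  let U : Finset ℂ := (Finset.range (d * M * k ^ 2 + 1)).image fun t : ℕ => ((t + 2 : ℕ) : ℂ)
  have hU : d * M * k ^ 2 + 1 ≤ U.card := by
    rw [Finset.card_image_of_injective _ (fun a b hab => by exact_mod_cast (Nat.cast_injective hab : a + 2 = b + 2) |> Nat.add_right_cancel),
      Finset.card_range]
  obtain ⟨β, -, hβ⟩ := hSS ℂ k d M dd hdd (fun i j => rename κ (ℓ i j)) hℓ' hD' U hU
  -- a non-root `y*` of the reduced polynomial
  obtain ⟨y, hy⟩ : ∃ y : Fin k → ℂ, eval y (MvPolynomial.aeval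
      (fun i : Fin M => ∑ j : Fin k,
        C (β ^ ((i.1 + 1) * (j.1 + 1))) * (X j : MvPolynomial (Fin k) ℂ))
      (∑ i, ∏ j, rename κ (ℓ i j))) ≠ 0 := by
    by_contra hcon
    push Not at hcon
    exact hβ (MvPolynomial.funext fun v => by simpa using hcon v)
  -- the point reached, pulled back to the coefficient variables, is a generator value
  rw [LowDegreeEquations.eval_comp_aeval] at hy
  have hsum : (∑ i, ∏ j, rename κ (ℓ i j)) = rename κ (∑ i, ∏ j, ℓ i j) := by
    simp only [map_sum, map_prod]
  rw [hsum, eval_rename] at hy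
  -- realise that point
  obtain ⟨f, hf, hcoeff⟩ := realisable hn hk (fun j : Fin k => β ^ ((j : ℕ) + 1) * y j)
    (fun j l => β ^ (((j : ℕ) + 1) * (n + 1) ^ (l : ℕ)))
  refine ⟨f, hf, ?_⟩
  have hκv : ∀ μ : degLEMonomials n,
      ((κ μ : Fin M) : ℕ) = ∑ l : Fin n, (μ : Fin n →₀ ℕ) l * (n + 1) ^ (l : ℕ) := fun μ => rfl
  have hv : coeffVector (degLEMonomials n) f =
      ((fun i : Fin M => eval y (∑ j : Fin k,
        C (β ^ ((i.1 + 1) * (j.1 + 1))) * (X j : MvPolynomial (Fin k) ℂ))) ∘ κ) := by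
    funext μ
    rw [coeffVector_apply, hcoeff μ, Function.comp_apply]
    simp only [map_sum, map_mul, eval_C, eval_X]
    refine Finset.sum_congr rfl fun j _ => ?_
    rw [hκv μ, pow_kronecker (n := n) β j (μ : Fin n →₀ ℕ)]
    ring
  rw [hv]
  exact hy

/-- **`ΣΠΣ(k)` distinguishers are hit, conditionally** (named-fact form of `stub_spskHit`): assuming
`SaxenaSeshadhri2012_lemma11`, for `n ≥ 8`, `k ≤ n`, `SmallCircuits ℂ n 10` hits every nonzero
`Σ_{i<k} ∏_j ℓ_{ij}` with affine `ℓ_{ij}`. [cite: ForbesShpilkaVolk2018, Cor. 22] [cite: SaxenaSeshadhri2012, Lemma 11] -/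
theorem isSuccinctHittingSet_spsk (hSS : Literature.Computability.AlgebraicComplexity.SaxenaSeshadhri2012_lemma11) {n k : ℕ} (hn : 8 ≤ n)
    (hk : k ≤ n) :
    IsSuccinctHittingSet (degLEMonomials n) (SmallCircuits ℂ n 10)
      {D | ∃ (dd : Fin k → ℕ) (ℓ : (i : Fin k) → Fin (dd i) → MvPolynomial (degLEMonomials n) ℂ),
        (∀ i j, (ℓ i j).totalDegree ≤ 1) ∧ D = ∑ i, ∏ j, ℓ i j} :=
  stub_spskHit hSS n k hn hk

/-- **No `ΣΠΣ(k)` natural proofs against `VP` in regime `d = n`, conditionally**: assuming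
`SaxenaSeshadhri2012_lemma11`, for `n ≥ 8`, `k ≤ n`, `b ≥ 10` and any class `𝒟`, no `ΣΠΣ(k)`
polynomial in the coefficient variables is an algebraically natural proof against
`SmallCircuits ℂ n b`. [cite: ForbesShpilkaVolk2018, Def. 1 and Cor. 22] -/
theorem not_isNaturalProof_spsk (hSS : Literature.Computability.AlgebraicComplexity.SaxenaSeshadhri2012_lemma11) {n k b : ℕ} (hn : 8 ≤ n)
    (hk : k ≤ n) (hb : 10 ≤ b) (𝒟 : Set (MvPolynomial (degLEMonomials n) ℂ))
    (dd : Fin k → ℕ) (ℓ : (i : Fin k) → Fin (dd i) → MvPolynomial (degLEMonomials n) ℂ)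
    (hℓ : ∀ i j, (ℓ i j).totalDegree ≤ 1) :
    ¬ IsNaturalProof (degLEMonomials n) (SmallCircuits ℂ n b) 𝒟 (∑ i, ∏ j, ℓ i j) := by
  rintro ⟨-, hD0, hvan⟩
  obtain ⟨f, hf, hne⟩ := isSuccinctHittingSet_spsk hSS hn hk _ ⟨dd, ℓ, hℓ, rfl⟩ hD0
  exact hne (hvan f (smallCircuits_mono ℂ hb (by omega) hf))

end Summit.ValiantsHypothesis.ValiantsHypothesis.Theorems.BarrierLever.SuccinctHittingSetsForVP
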